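import Literature.NumberTheory.LFunctions.SchoenfeldPiLargeBounds
import Literature.NumberTheory.LFunctions.SchoenfeldExplicitNumerics
import HarnessLib

/-!
# Schoenfeld 1976, Cor. 1 on `[10⁸, ∞)`: `|π(x) − li(x)| < √x log x/(8π)` under RH, without tables

Topic: `Literature/NumberTheory/LFunctions`. THEOREMS (everything proved). The analytic range of
the discharge of `Literature.NumberTheory.LFunctions.schoenfeld_explicit` (L. Schoenfeld, *Sharper bounds for the
Chebyshev functions θ(x) and ψ(x). II*, Math. Comp. 30 (1976), Cor. 1 (6.18): under RH,
`|π(x) − li(x)| < √x log x/(8π)` for `x ≥ 2657`). Schoenfeld proves (6.18) analytically only for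
`x ≥ 23·10⁸` (from (6.1), `|θ(x) − x| < √x (log x − 2) log x/(8π)`) and covers `[2657, 23·10⁸]` by
the tables of Brent and Appel–Rosser. Here the analytic range is brought down to `x ≥ 10⁸` by

1. the differenced explicit formula for `ψ₁` with the zeros split at `T = 5√x/11`, step `h = 5√x`
   (`SchoenfeldPsiDifference.lean`), the certified first `2000` zeros below height `2516` and the
   explicit `N(T)` above it (`SchoenfeldZerosLow.lean`, `SchoenfeldZeroSumsExplicit.lean`):
   `x − ψ(x) ≤ E⁻(x)` (`sub_psi_le_Eminus`), `ψ(x) − x ≤ E⁻(x) − 2 log 2π + 0.41 √x`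
   (`psi_sub_le_Eplus`);
2. the passage to `π − li` through Rosser–Schoenfeld's identity
   `π(x) − li(x) = (θ(x) − x)/log x + ∫_ξ^x (θ(t) − t) dt/(t log² t) − ξ'`
   (`Literature.NumberTheory.LFunctions.primeCounting_sub_logIntegral_eq`, `ξ = 10⁴`, `|ξ'| ≤ 25/π` certified in
   `SchoenfeldExplicitNumerics.lean`), where — unlike Schoenfeld's pointwise `|θ(t) − t| ≤ √t log² t/(8π)`,
   which costs `√x/(4π)` — the integral is split as `∫ (ψ − t) w − ∫ (ψ − θ) w` and the first part
   is integrated by parts against `ψ₁` (`SchoenfeldPiIntegral.lean`), costing only `O(√x/log² x)`;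
   `0 ≤ ψ − θ ≤ 1.0925 √x` (`x ≥ 10⁸`) and `≤ 1.33 √t` (`t ≥ 10⁴`) from `ψ(y) ≤ 1.04 y`;
3. the elementary inequality `key_ineq` of `SchoenfeldPiLargeBounds.lean` on `[10⁸, ∞)`.

Main result: `abs_primeCounting_sub_logIntegral_lt_of_ge` — **under RH, for `x ≥ 10⁸`,
`|π(x) − li(x)| < √x log x/(8π)`**. The range `[2657, 10⁸)` is a finite computation
(`SchoenfeldSieve.lean`).

## References

* L. Schoenfeld, Math. Comp. 30 (1976), 337–360, Thm. 10, Cor. 1 (6.18) and its proof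
  (pp. 337–340). [Schoenfeld1976]
* J. B. Rosser, L. Schoenfeld, Illinois J. Math. 6 (1962), 64–94, (4.17). [RosserSchoenfeld1962]
-/

noncomputable section

open Real MeasureTheory Set intervalIntegral
open scoped Chebyshev

namespace Literature.NumberTheory.LFunctions

namespace SchoenfeldBound

open NicolasJ NicolasJExplicit

/-! ### The two bounds for `ψ(x) − x` at `T = 5√x/11`, `h = 5√x` -/

/-- Basic facts at `x ≥ 10⁸`: `√x ≥ 10⁴`, `T = 5√x/11 ≥ 2516`. [folklore] -/
theorem sqrt_ge_of_ge {x : ℝ} (hx : (10 : ℝ) ^ 8 ≤ x) : 10000 ≤ Real.sqrt x ∧ 2516 ≤ Tpar x := by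
  have hs8 : Real.sqrt ((10 : ℝ) ^ 8) = 10000 := by
    rw [show ((10 : ℝ) ^ 8) = 10000 ^ 2 by norm_num, Real.sqrt_sq (by norm_num)]
  have hs4 : 10000 ≤ Real.sqrt x := by rw [← hs8]; exact Real.sqrt_le_sqrt hx
  exact ⟨hs4, by unfold Tpar; linarith⟩

/-- **`x − ψ(x) ≤ E⁻(x)` for `x ≥ 10⁸`, under RH** (`neg_le_psi_sub_self` with `h = 5√x`,
`T = 5√x/11`, `sumInvNorm T ≤ Abnd x`, `β − sumInvNormSq T ≤ 2G(T)`). [cite: Schoenfeld1976, Thm. 10] -/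
theorem sub_psi_le_Eminus (hRH : RiemannHypothesis) {x : ℝ} (hx : (10 : ℝ) ^ 8 ≤ x) : x - ψ x ≤ Eminus x := by
  obtain ⟨hs4, hT⟩ := sqrt_ge_of_ge hx
  have hx0 : 0 < x := by linarith [show (0 : ℝ) < 10 ^ 8 by norm_num]
  have hs : 0 < Real.sqrt x := by linarith
  have hsx : Real.sqrt x * Real.sqrt x = x := Real.mul_self_sqrt hx0.le
  set h : ℝ := 5 * Real.sqrt x with hh
  have hh0 : 0 < h := by positivity
  have hxh : 1 < x - h := by rw [hh]; nlinarith
  have hmain := neg_le_psi_sub_self hRH hh0 hxh (Tpar x)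
  have hA : sumInvNorm (Tpar x) ≤ Abnd x := sumInvNorm_le_explicit hT
  have hB : nicolasBeta - sumInvNormSq (Tpar x) ≤ 2 * Gtail (Tpar x) := tail_le_explicit hRH hT
  have h32 : x ^ (3 / 2 : ℝ) = x * Real.sqrt x := rpow_three_halves hx0.le
  rw [h32] at hmain
  have hcoef : 0 ≤ 2 * (x * Real.sqrt x) / h := by positivity
  have e1 : 2 * (x * Real.sqrt x) / h = 4 * x / 5 / 2 := by rw [hh]; field_simp; ring
  have m1 : Real.sqrt x * sumInvNorm (Tpar x) ≤ Real.sqrt x * Abnd x := mul_le_mul_of_nonneg_left hA hs.le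
  have m2 : 2 * (x * Real.sqrt x) / h * (nicolasBeta - sumInvNormSq (Tpar x)) ≤
      2 * (x * Real.sqrt x) / h * (2 * Gtail (Tpar x)) := mul_le_mul_of_nonneg_left hB hcoef
  rw [e1] at m2
  unfold Eminus
  have : 4 * x / 5 / 2 * (2 * Gtail (Tpar x)) = 4 * x / 5 * Gtail (Tpar x) := by ring
  rw [e1, hh] at hmain
  linarith

/-- **`ψ(x) − x ≤ E⁻(x) − 2 log 2π + 0.41 √x` for `x ≥ 10⁸`, under RH** (`psi_sub_self_le` with the
same parameters; `√(x+h) ≤ √x + 5/2`, `(x+h)^{3/2} ≤ (x + 5√x)(√x + 5/2)`, `x/(2h(x²−1)) ≤ 1`, and the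
lower-order terms absorbed by `aux_upper`). [cite: Schoenfeld1976, Thm. 10] -/
theorem psi_sub_le_Eplus (hRH : RiemannHypothesis) {x : ℝ} (hx : (10 : ℝ) ^ 8 ≤ x) :
    ψ x - x ≤ Eminus x - 2 * Real.log (2 * π) + 0.41 * Real.sqrt x := by
  obtain ⟨hs4, hT⟩ := sqrt_ge_of_ge hx
  have hx0 : 0 < x := by linarith [show (0 : ℝ) < 10 ^ 8 by norm_num]
  have hx1 : 1 < x := by linarith [show (1 : ℝ) < 10 ^ 8 by norm_num]
  have hs : 0 < Real.sqrt x := by linarith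
  have hsx : Real.sqrt x * Real.sqrt x = x := Real.mul_self_sqrt hx0.le
  set s := Real.sqrt x with hsdef
  set h : ℝ := 5 * s with hh
  have hh0 : 0 < h := by positivity
  have hmain := psi_sub_self_le hRH hx1 hh0 (Tpar x)
  have hA : sumInvNorm (Tpar x) ≤ Abnd x := sumInvNorm_le_explicit hT
  have hA0 : 0 ≤ Abnd x := (sumInvNorm_nonneg _).trans hA
  have hB : nicolasBeta - sumInvNormSq (Tpar x) ≤ 2 * Gtail (Tpar x) := tail_le_explicit hRH hT
  have hB0 : 0 ≤ nicolasBeta - sumInvNormSq (Tpar x) := by linarith [sumInvNormSq_le_nicolasBeta hRH (Tpar x)]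
  have hG0 : 0 ≤ Gtail (Tpar x) := by linarith
  have hxh0 : 0 ≤ x + h := by positivity
  -- `√(x+h) ≤ s + 5/2`, `(x+h)^{3/2} ≤ (x+h)(s+5/2)`
  have hsq : Real.sqrt (x + h) ≤ s + 5 / 2 := by
    rw [Real.sqrt_le_left (by positivity)]
    rw [hh]; nlinarith
  have h32 : (x + h) ^ (3 / 2 : ℝ) = (x + h) * Real.sqrt (x + h) := rpow_three_halves hxh0
  rw [h32] at hmain
  -- the four terms
  have m1 : Real.sqrt (x + h) * sumInvNorm (Tpar x) ≤ (s + 5 / 2) * Abnd x :=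
    mul_le_mul hsq hA (sumInvNorm_nonneg _) (by positivity)
  have m2 : 2 * ((x + h) * Real.sqrt (x + h)) / h * (nicolasBeta - sumInvNormSq (Tpar x)) ≤
      2 * ((x + h) * (s + 5 / 2)) / h * (2 * Gtail (Tpar x)) := by
    refine mul_le_mul ?_ hB hB0 (by positivity)
    refine div_le_div_of_nonneg_right ?_ hh0.le
    nlinarith [mul_le_mul_of_nonneg_left hsq hxh0]
  have m2' : 2 * ((x + h) * (s + 5 / 2)) / h * (2 * Gtail (Tpar x)) ≤
      (4 * x / 5 + 6.4 * s) * Gtail (Tpar x) := by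
    have e : 2 * ((x + h) * (s + 5 / 2)) / h = 2 / 5 * ((s + 5) * (s + 5 / 2)) := by
      rw [hh, ← hsx]; field_simp
    rw [e]
    have hle : 2 / 5 * ((s + 5) * (s + 5 / 2)) * 2 ≤ 4 * x / 5 + 6.4 * s := by rw [← hsx]; nlinarith
    nlinarith
  have m3 : x / (2 * h * (x ^ 2 - 1)) ≤ 1 := by
    rw [div_le_one (by rw [hh]; nlinarith)]
    rw [hh]; nlinarith
  have haux := aux_upper hx
  unfold Eminus at haux ⊢
  rw [← hsdef] at haux ⊢
  linarith

/-- **Under RH, `ψ(x) − θ(x) ≤ 1.0925 √x` for `x ≥ 10⁸`** (`x^{1/3} ≤ √x/21.54`, `x^{1/5} ≤ √x/6.3³`).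
[cite: RosserSchoenfeld1962, (3.39)] -/
theorem psi_sub_theta_le_large (hRH : RiemannHypothesis) {x : ℝ} (hx : (10 : ℝ) ^ 8 ≤ x) :
    ψ x - θ x ≤ 1.0925 * Real.sqrt x := by
  have h := psi_sub_theta_le hRH (x := x) (by linarith [show (0 : ℝ) < 10 ^ 8 by norm_num])
  have h3 := rpow_third_le (c := 21.54) (t := x) (by norm_num) (le_trans (by norm_num) hx)
  have h5 := rpow_fifth_le (c := 6.3) (t := x) (by norm_num) (le_trans (by norm_num) hx)
  have hs : 0 ≤ Real.sqrt x := Real.sqrt_nonneg x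
  have h3' : x ^ (1 / 3 : ℝ) ≤ 0.046426 * Real.sqrt x := by
    refine h3.trans ?_; rw [div_le_iff₀ (by norm_num)]; nlinarith
  have h5' : x ^ (1 / 5 : ℝ) ≤ 0.004 * Real.sqrt x := by
    refine h5.trans ?_; rw [div_le_iff₀ (by norm_num)]; nlinarith
  nlinarith

/-! ### The main theorem on `[10⁸, ∞)` -/

/-- **Schoenfeld 1976, Cor. 1 (6.18) on `[10⁸, ∞)`: under the Riemann hypothesis,
`|π(x) − li(x)| < √x log x/(8π)` for every `x ≥ 10⁸`** (`π(x) = Nat.primeCounting ⌊x⌋₊`,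
`li = Literature.logIntegral`). No tables: the explicit formula, the certified zeros below `2516`,
`N(T)`, and one elementary inequality. [cite: Schoenfeld1976, Cor. 1 (6.18)] -/
theorem abs_primeCounting_sub_logIntegral_lt_of_ge (hRH : RiemannHypothesis) {x : ℝ} (hx : (10 : ℝ) ^ 8 ≤ x) :
    |(Nat.primeCounting ⌊x⌋₊ : ℝ) - logIntegral x| < Real.sqrt x * Real.log x / (8 * π) := by
  obtain ⟨hs4, -⟩ := sqrt_ge_of_ge hx
  have hx0 : 0 < x := by linarith [show (0 : ℝ) < 10 ^ 8 by norm_num]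
  have hx1 : 1 < x := by linarith [show (1 : ℝ) < 10 ^ 8 by norm_num]
  have hξx : (10000 : ℝ) ≤ x := le_trans (by norm_num) hx
  have hs : 0 < Real.sqrt x := by linarith
  have hl : 0 < Real.log x := Real.log_pos hx1
  have hπ := Real.pi_pos
  -- the identity and its pieces
  have hid := primeCounting_sub_logIntegral_eq (ξ := 10000) (x := x) (by norm_num) hξx
  have hanchor := SchoenfeldNumerics.schoenfeld_anchor_10000
  have hs100 : Real.sqrt 10000 = 100 := by
    rw [show (10000 : ℝ) = 100 ^ 2 by norm_num, Real.sqrt_sq (by norm_num)]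
  rw [hs100] at hanchor
  have hfl : ⌊(10000 : ℝ)⌋₊ = 10000 := by simp
  rw [hfl] at hanchor
  have hsplit := integral_theta_sub_eq (ξ := 10000) (x := x) (by norm_num) hξx
  have hI : |∫ t in (10000 : ℝ)..x, (ψ t - t) * wt t| ≤ IpsiB x :=
    abs_integral_psi_sub_mul_w_le hRH (by norm_num) hξx
  obtain ⟨hJ0, hJ1⟩ := integral_psi_sub_theta_mul_w hRH le_rfl hξx
  have hK := integral_inv_sqrt_log_sq_le_Kbnd hx
  have hKnn := Kbnd_nonneg hx
  have hDlo : 0 ≤ ψ x - θ x := sub_nonneg.2 (Chebyshev.theta_le_psi x)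
  have hDhi := psi_sub_theta_le_large hRH hx
  have hlow := sub_psi_le_Eminus hRH hx
  have hup := psi_sub_le_Eplus hRH hx
  have hkey := key_ineq hx
  have hL2 : 0 < Real.log (2 * π) := Real.log_pos (by linarith [Real.pi_gt_three])
  -- abbreviate and make the literal-laden atoms opaque
  set I := ∫ t in (10000 : ℝ)..x, (ψ t - t) * wt t with hIdef
  set J := ∫ t in (10000 : ℝ)..x, (ψ t - θ t) * wt t with hJdef
  have hfl' : ⌊(10000 : ℝ)⌋₊ = 10000 := by simp
  rw [hsplit, hfl'] at hid
  generalize (logIntegral 10000 - (Nat.primeCounting 10000 : ℝ)) - (10000 - θ 10000) / Real.log 10000 = ξ' at hid hanchor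
  have hIlo : -IpsiB x ≤ I := (abs_le.1 hI).1
  have hIhi : I ≤ IpsiB x := (abs_le.1 hI).2
  have hξlo : -(25 / π) ≤ ξ' := by have := (abs_le.1 hanchor).1; linarith [show (100 : ℝ) / (4 * π) = 25 / π by ring]
  have hξhi : ξ' ≤ 25 / π := by have := (abs_le.1 hanchor).2; linarith [show (100 : ℝ) / (4 * π) = 25 / π by ring]
  have hJhi : J ≤ 1.33 * Kbnd x := hJ1.trans (mul_le_mul_of_nonneg_left hK (by norm_num))
  clear hI hanchor hJ1 hK hsplit hIdef hJdef
  -- multiply the identity by `log x`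
  have hmul : Real.log x * ((Nat.primeCounting ⌊x⌋₊ : ℝ) - logIntegral x) =
      (ψ x - x) - (ψ x - θ x) + Real.log x * I - Real.log x * J - Real.log x * ξ' := by
    rw [hid]
    field_simp
    ring
  have t1 : Real.log x * (-IpsiB x) ≤ Real.log x * I := mul_le_mul_of_nonneg_left hIlo hl.le
  have t2 : Real.log x * J ≤ Real.log x * (1.33 * Kbnd x) := mul_le_mul_of_nonneg_left hJhi hl.le
  have t3 : Real.log x * I ≤ Real.log x * IpsiB x := mul_le_mul_of_nonneg_left hIhi hl.le
  have t4 : 0 ≤ Real.log x * J := mul_nonneg hl.le hJ0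
  have t5 : Real.log x * (-(25 / π)) ≤ Real.log x * ξ' := mul_le_mul_of_nonneg_left hξlo hl.le
  have t6 : Real.log x * ξ' ≤ Real.log x * (25 / π) := mul_le_mul_of_nonneg_left hξhi hl.le
  have t7 : 0 ≤ Real.log x * Kbnd x := mul_nonneg hl.le hKnn
  have hs0 : 0 ≤ Real.sqrt x := hs.le
  have hlower : -(Real.sqrt x * Real.log x ^ 2 / (8 * π)) <
      Real.log x * ((Nat.primeCounting ⌊x⌋₊ : ℝ) - logIntegral x) := by
    rw [hmul]
    linarith only [hkey, hlow, hDhi, t1, t2, t5, t6]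
  have hupper : Real.log x * ((Nat.primeCounting ⌊x⌋₊ : ℝ) - logIntegral x) <
      Real.sqrt x * Real.log x ^ 2 / (8 * π) := by
    rw [hmul]
    linarith only [hkey, hup, hDlo, t3, t4, t5, t6, t7, hL2, hs0]
  -- divide by `log x`
  have e : Real.sqrt x * Real.log x ^ 2 / (8 * π) / Real.log x = Real.sqrt x * Real.log x / (8 * π) := by
    field_simp
  have h1 : (Nat.primeCounting ⌊x⌋₊ : ℝ) - logIntegral x < Real.sqrt x * Real.log x / (8 * π) := by
    have : (Nat.primeCounting ⌊x⌋₊ : ℝ) - logIntegral x < Real.sqrt x * Real.log x ^ 2 / (8 * π) / Real.log x :=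
      (lt_div_iff₀ hl).2 (by linarith)
    rwa [e] at this
  have h2 : -(Real.sqrt x * Real.log x / (8 * π)) < (Nat.primeCounting ⌊x⌋₊ : ℝ) - logIntegral x := by
    have : -(Real.sqrt x * Real.log x ^ 2 / (8 * π)) / Real.log x < (Nat.primeCounting ⌊x⌋₊ : ℝ) - logIntegral x :=
      (div_lt_iff₀ hl).2 (by linarith)
    rwa [neg_div, e] at this
  exact abs_lt.2 ⟨h2, h1⟩

end SchoenfeldBound

end Literature.NumberTheory.LFunctions

end
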